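/-
Copyright (c) 2026 the pub-hodgecm-mathlib formalisation cell (harness21).  Prover seat hodgecm-mathlib-K2E3-p12 (g6): Track B «K2-LIT», ENGINE E1 (on loan
per chair word «β → E1»), h413 = stmt-HodgeConjecture-24833; campaign «EIS-WHITTAKER-2» of the dealer K2E1-plan (g4), rung W3 (deal 2026-09-04T07:19:01Z), FILE 2 of 2:
the Whittaker coefficient of the spherical flat section of `U(1,1)_{L∕L⁺}` at `g = k ∈ K_U`.
-/
import Summits.HodgeConjecture.HodgeConjecture.Theorems.K2E1AdelicFourierCoeffEulerProduct          -- W3 FILE 1 (this seat): split, finite Euler product, archimedean product, regrouping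
import Summits.HodgeConjecture.HodgeConjecture.Theorems.K2E1IntertwiningLocalFactorU2Line         -- ★ p858204: `h_f(b) = ∏ᶠ_v P_v(b_v)`, `P_v` continuous, `= 1` on `𝒪_v` off `S_δ`
import Summits.HodgeConjecture.HodgeConjecture.Theorems.K2E1HeightBigCellLineFormulaU2            -- ★ p857981: `H(ι(w₀)·n(θ(ι⁻¹s,b))·k) = (A(s)·h_f(b))⁻¹`
import Summits.HodgeConjecture.HodgeConjecture.Theorems.K2E1BorelEisensteinUDefs                  -- ★ p857359: `flatSectionU φ z g = φ g · H(g)^z`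
import Literature.NumberTheory.Automorphic.MixedSpaceUnitsMellinProduct                           -- ★ `ofReal_prod_cpow` (`(∏ aᵢ)^w = ∏ aᵢ^w`, `aᵢ ≥ 0`)
import Mathlib.NumberTheory.NumberField.CMField
import HarnessLib

/-!
# K2·E1 — `K2E1WhittakerCoefficientEulerProductU2` («EIS-WHITTAKER-2», rung W3, FILE 2 of 2): THE WHITTAKER COEFFICIENT OF THE SPHERICAL FLAT SECTION OF `U(1,1)_{L∕L⁺}` IS AN
# EULER PRODUCT — `μ(D)⁻¹·Φ̂_k(ξ) = |d_{L⁺}|^{−1∕2}·φ₀·∏_{w∣∞} 𝓦_w(ξ, z)·(μ_f(𝒪̂)⁻¹∫ h_f^{−z}ψ_f(ξ·))`, `μ_f(𝒪̂)⁻¹∫ h_f^{−z}ψ_f(ξ·) = ∏'_v W_v(ξ, z) = (∏_{v∈S} W_v)·ζ^S_{L⁺}(2z)⁻¹`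

Track B ∕ K2-LIT, crux h413 = `stmt-HodgeConjecture-24833`, route of record `HCCMUnconditional`; cell `hodgecm-mathlib`, squad K2, ENGINE E1, campaign «EIS-WHITTAKER-2».  DEAL W3 of
K2E1-plan (g4) 07:19:01Z; typed AGAINST the conventions memo of record `K2/K2E1b-plan/g5/CONVENTIONS-W3W4-EisWhittaker2.K2E1b-plan-g5.md` §0 (R), §1, §2.  THEOREMS ONLY (no `def`, no
instance, no notation, no named-fact hypothesis, no `sorry`; default heartbeats); lane `--supports stmt-HodgeConjecture-24833 --as helper` (count-neutral, closes no socket).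

THE MATHEMATICS [Garrett2018 §1.9–§1.10, §2.8; Bump1997 §3.7; MoeglinWaldspurger1995 II.1.7; TateThesis1967 §4.1].  In W1 ★ `eisensteinSeriesU_sub_borelConstantTerm_eq_two` (`E(f)(g) − E(f)_B(g) =
μ(D)⁻¹·Σ_{ξ≠0} Φ̂_g(ξ)`, `Φ_g(t) = f(ι(w₀)·n(tδ)·g)`) take the spherical flat section `f = flatSectionU (fun _ => φ₀) z = φ₀·H^z` and `g = k ∈ K_U` (W3-cov, K2E4-p14 (g6), moves a general `g` here).
By ★ p857981 the big-cell function along the line is a PURE TENSOR in the split coordinates `t = (ι⁻¹ s, b)`, `s ∈ L⁺ ⊗ ℝ`, `b ∈ 𝔸_{L⁺,f}`: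
`Φ_k(ι⁻¹s, b) = φ₀·A(s)^{−z}·h_f(b)^{−z}`, `A(s) = ∏_{w∣∞ of L}(1 + (wδ)²·s_{w|L⁺}²) > 0`, `h_f(b) = ∏ᶠ_v P_v(b_v) ≥ 1`, `P_v(t) = ∏_{w∣v} max(1, ‖ι_w t‖_w‖δ‖_w)` (`= max(1,‖t‖_v)²` off the finite `S_δ`,
★ `K2E1IntertwiningLocalFactorU2Line`).  With the split Haar measure `μ = σ_*(volume ⊗ μ_f)` of FILE 1 (`μ_f` ANY Haar on `𝔸_{L⁺,f}`, `ν_v` ANY Haar on `L⁺_v`):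
* §1 **`coe_borelHeight_weylLongU_line_cpow_eq_cm_two`** — `(H(ι(w₀)·n(θ(ι⁻¹s,b))·k) : ℂ)^z = A(s)^{−z}·h_f(b)^{−z}` (★ p857981 read with a complex exponent), hence
  **`flatSectionU_const_weylLongU_line_eq_cm_two`** — W1's `Φ_k` IS the explicit tensor `t ↦ (φ₀·A(ι t_∞)^{−z})·h_f(t_f)^{−z}` (the `hΦ` of ★ W1 :224 discharged by `funext`);
  **`coe_finFactor_cpow_eq_finprod`** — `h_f(b)^{−z} = ∏ᶠ_v P_v(b_v)^{−z}` in `ℂ` (★ `finprod_max_one_nnnorm_traceZeroLine_snd_eq` through the hom `x ↦ x^{−z}` of `ℝ≥0`).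
* §2 HEAD **`inv_measure_mul_adeleFourierCoeff_line_eq_cm_two`** (memo §0 (R), `z` UNRESTRICTED — both sides carry the same Bochner junk):
  `μ(D)⁻¹·Φ̂_k(ξ) = (√|d_{L⁺}|)⁻¹ · (φ₀·∏_{w∣∞ of L} ∫_ℝ (1 + (wδ)²x²)^{−z}·e^{−2πi·ξ_w·x} dx) · (μ_f(𝒪̂)⁻¹·∫ h_f(b)^{−z}·ψ_f(ξb) dμ_f(b))`, `ξ_w = (mixedEmbedding L⁺ ξ)_{w|L⁺}` — each archimedean factor is
  ★ W2-arch `integral_onePlusSqPow_mul_phase_eq` :144 VERBATIM (`c = (wδ)² > 0`, entire in `z` for `ξ ≠ 0` by ★ §4, strip bound ★ §5).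
* §3 **`hasProd_localWhittaker_line_cm_two`** — the finite factor is the Euler product of the LOCAL WHITTAKER INTEGRALS `W_v(ξ,z) = ν_v(𝒪_v)⁻¹·∫_{L⁺_v} P_v(t)^{−z}·ψ_v(ξt) dν_v(t)`:
  `HasProd W (μ_f(𝒪̂)⁻¹·∫ h_f^{−z}·ψ_f(ξ·) dμ_f)` under the single binder `hint : h_f^{−z} ∈ L¹(μ_f)` (= `h_f^{−Re z} ∈ L¹`, true for `Re z > 1`: Godement at CM, payer K2E2-p12 (g4) «R7₂ FILE 3
  (3b)» `K2E1IntertwiningScalarLineIntegralU2` §3 — hypothesis-first here; `P_v^{−z}` is W2-fin's integrand `max(1,‖t‖_v)^{−2z}` off `S_δ`, K2-defs1 (g4)).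
* §4 **`inv_measure_mul_adeleFourierCoeff_line_eq_prod_cm_two`** — with the NAMED unramified values `hW : ∀ v ∉ S, W_v(ξ,z) = 1 − q_v^{−2z}` (W2-fin (d) at `ord_v ξ = m_v`, conductor letter
  `m_v` of the memo §0 (S)) on `Re z > ½`:  `μ(D)⁻¹·Φ̂_k(ξ) = (√|d_{L⁺}|)⁻¹·(φ₀·∏_w 𝓦_w)·(∏_{v∈S} W_v(ξ,z))·ζ^S_{L⁺}(2z)⁻¹` (FILE 1 §4 + `HasProd.unique`) — the form W4 ★ ∕ W5-A ★ consume: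
  entire × polynomial in `q_v^{−z}` × `1∕ζ^S_{L⁺}(2z)` (holomorphic on `Re z > ½`, ★ p857988 §2); at `ξ = 0`, `z ↦ σ` real it is R7₂ FILE 3's `c(σ)` letter for letter.
HONEST LABEL: HC_CM is proved only modulo the 7 printed citations (2 remaining named inputs: hLiu418 = `stmt-HodgeConjecture-24832`, h413 = `stmt-HodgeConjecture-24833`) until rung 0
closes; this file asserts no named fact and closes no socket; count-neutral.  Named inputs of the corollaries: `hint` (Godement, ★-pending (3b)), `hW` (W2-fin (d), in typing).

## References
* [Garrett2018] P. Garrett, *Modern Analysis of Automorphic Forms by Example* 1 (2018), §1.9–§1.10, §2.8.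
* [Bump1997] D. Bump, *Automorphic Forms and Representations* (1997), §1.6 (1.26)–(1.27), §3.7.
* [MoeglinWaldspurger1995] C. Mœglin, J.-L. Waldspurger, *Spectral Decomposition and Eisenstein Series* (1995), I.2.2, II.1.7.
* [TateThesis1967] J. Tate, *Fourier analysis in number fields and Hecke's zeta-functions*, in Cassels–Fröhlich (1967), Ch. XV, §3.3, §4.1.
-/

set_option autoImplicit false
set_option linter.dupNamespace false -- the mandated namespace repeats `HodgeConjecture.HodgeConjecture`

noncomputable section

open MeasureTheory Measure NumberField NumberField.InfinitePlace NumberField.mixedEmbedding IsDedekindDomain IsDedekindDomain.HeightOneSpectrum Set Filter Topology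
open scoped ENNReal NNReal Real FourierTransform Classical
open Literature.NumberTheory.Automorphic Literature.NumberTheory.Automorphic.UnitaryGroup AdelicGroupData
open Literature.NumberTheory.GaloisRepresentations.IsNonarchimedeanLocalField
open Summit.HodgeConjecture.HodgeConjecture.Cruxes.H413
open Summit.HodgeConjecture.HodgeConjecture.Cruxes.H413.K2E1AdelicFourierCoeffEulerProduct
open Summit.HodgeConjecture.HodgeConjecture.Cruxes.H413.K2E1HeightBigCellLineFormulaU2 (coe_borelHeight_weylLongU_line_mul_eq_cm_two one_le_coe_finprod_line_cm_two sq_apply_pos_of_ne_zero)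
open Summit.HodgeConjecture.HodgeConjecture.Cruxes.H413.K2E1IntertwiningLocalFactorU2Line (finprod_max_one_nnnorm_traceZeroLine_snd_eq prod_extension_max_one_eq_one_of_mem_integers continuous_prod_extension_max_one finite_setOf_exists_extension_normAbs_ne_one)
open Summit.HodgeConjecture.HodgeConjecture.Cruxes.H413.K2E1BorelEisensteinU (flatSectionU flatSectionU_apply)

namespace Summit.HodgeConjecture.HodgeConjecture.Cruxes.H413.K2E1WhittakerCoefficientEulerProductU2

variable (L : Type) [Field L] [NumberField L] [IsCMField L]
  (hij : (((0 : Fin 2) : ℕ)) + 1 = ((1 : Fin 2) : ℕ)) (hN : 2 = 2 * ((0 : Fin 2) : ℕ) + 2)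
  {δ : L} (hcδ : IsCMField.complexConj L δ = -δ) (hδ : δ ≠ 0)

/-! ## §1 The big-cell function of the spherical flat section along the line is a pure tensor -/

omit [IsCMField L] in
/-- `0 < A(s) = ∏_{w∣∞}(1 + (wδ)²·s_w²)`. [folklore] -/
theorem archFactor_pos (s : mixedSpace ↥(maximalRealSubfield L)) :
    0 < ∏ w : InfinitePlace L, ((1 : ℝ) + (w δ) ^ 2 * (s.1 ⟨w.comap (algebraMap ↥(maximalRealSubfield L) L), K2E1HeightBigCellLineFormulaU2.isReal_comap_maximalRealSubfield L w⟩) ^ 2) :=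
  Finset.prod_pos fun w _ => by positivity

/-- Complex-power algebra on the positive reals: `((a·h)⁻¹)^z = a^{−z}·h^{−z}` for `a, h > 0`. [folklore] -/
theorem ofReal_inv_mul_cpow {a h : ℝ} (ha : 0 < a) (hh : 0 < h) (z : ℂ) :
    (((a * h)⁻¹ : ℝ) : ℂ) ^ z = ((a : ℝ) : ℂ) ^ (-z) * ((h : ℝ) : ℂ) ^ (-z) := by
  have hah : 0 < a * h := mul_pos ha hh
  rw [Complex.ofReal_inv, Complex.inv_cpow _ _ (by rw [Complex.arg_ofReal_of_nonneg hah.le]; exact Real.pi_ne_zero.symm), Complex.ofReal_mul,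
    Complex.mul_cpow_ofReal_nonneg ha.le hh.le, mul_inv, Complex.cpow_neg, Complex.cpow_neg]

/-- **`(H(ι(w₀)·n(θ(ι⁻¹ s, b))·k))^z = A(s)^{−z} · h_f(b)^{−z}` in `ℂ`** for `k ∈ K_U` and every complex `z` (★ p857981 `coe_borelHeight_weylLongU_line_mul_eq_cm_two` read through `((A·h_f)⁻¹)^z`,
`A(s) > 0`, `h_f(b) ≥ 1`). [cite: MoeglinWaldspurger1995, I.2.2] [cite: Garrett2018, §2.8] -/
theorem coe_borelHeight_weylLongU_line_cpow_eq_cm_two {k : (quasiSplit (↥(maximalRealSubfield L)) L (IsCMField.complexConj L) 2).Adelic}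
    (hk : k ∈ ((standardMaximalCompactGL 2 L).comap (adelicVal ↥(maximalRealSubfield L) L (IsCMField.complexConj L) 2 ((StdForm.antidiagonal 2).over L)) : Subgroup (quasiSplit (↥(maximalRealSubfield L)) L (IsCMField.complexConj L) 2).Adelic))
    (z : ℂ) (s : mixedSpace ↥(maximalRealSubfield L)) (b : FiniteAdeleRing (𝓞 ↥(maximalRealSubfield L)) ↥(maximalRealSubfield L)) :
    ((borelHeight (((quasiSplit (↥(maximalRealSubfield L)) L (IsCMField.complexConj L) 2).toAdelic (weylLongU ((IsCMField.complexConj L : L ≃ₐ[↥(maximalRealSubfield L)] L) : L →+* L) (rfl : ((StdForm.antidiagonal 2).over L) = ((StdForm.antidiagonal 2).over L)))) *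
          ((middleRootUnipotent hij hN (Multiplicative.ofAdd (traceZeroLine ↥(maximalRealSubfield L) L (IsCMField.complexConj L) hcδ hδ (((InfiniteAdeleRing.ringEquiv_mixedSpace ↥(maximalRealSubfield L)).symm s, b) : AdeleRing (𝓞 ↥(maximalRealSubfield L)) ↥(maximalRealSubfield L)))) : ↥(adelicUnipotent ↥(maximalRealSubfield L) L (IsCMField.complexConj L) 2)) : (quasiSplit (↥(maximalRealSubfield L)) L (IsCMField.complexConj L) 2).Adelic) * k) : ℝ) : ℂ) ^ z =
      ((∏ w : InfinitePlace L, ((1 : ℝ) + (w δ) ^ 2 * (s.1 ⟨w.comap (algebraMap ↥(maximalRealSubfield L) L), K2E1HeightBigCellLineFormulaU2.isReal_comap_maximalRealSubfield L w⟩) ^ 2) : ℝ) : ℂ) ^ (-z) *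
        (((∏ᶠ v : HeightOneSpectrum (𝓞 L), max 1 ‖((traceZeroLine ↥(maximalRealSubfield L) L (IsCMField.complexConj L) hcδ hδ ((0, b) : AdeleRing (𝓞 ↥(maximalRealSubfield L)) ↥(maximalRealSubfield L)) : traceZeroAdele ↥(maximalRealSubfield L) L (IsCMField.complexConj L)) : AdeleRing (𝓞 L) L).2 v‖₊ : ℝ≥0) : ℝ) : ℂ) ^ (-z) := by
  rw [coe_borelHeight_weylLongU_line_mul_eq_cm_two L hij hN hcδ hδ hk b s]
  exact ofReal_inv_mul_cpow (archFactor_pos L s) (lt_of_lt_of_le one_pos (one_le_coe_finprod_line_cm_two L hcδ hδ b)) z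

/-- **W1's big-cell function `Φ_k` of the spherical flat section IS the explicit tensor**: for `k ∈ K_U` and every adele `t = (t_∞, t_f)` of `L⁺`,
`flatSectionU (fun _ => φ₀) z (ι(w₀)·n(θ t)·k) = (φ₀·A(ι t_∞)^{−z})·h_f(t_f)^{−z}` (`ι = ringEquiv_mixedSpace`; `t = (ι⁻¹(ι t_∞), t_f)`) — the binder `hΦ` of ★ W1 :224 at `g = k` holds by
`funext` for `Φ := t ↦ (φ₀·A(ι t_∞)^{−z})·h_f(t_f)^{−z}`. [cite: MoeglinWaldspurger1995, II.1.7] [cite: Garrett2018, §1.9] -/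
theorem flatSectionU_const_weylLongU_line_eq_cm_two {k : (quasiSplit (↥(maximalRealSubfield L)) L (IsCMField.complexConj L) 2).Adelic}
    (hk : k ∈ ((standardMaximalCompactGL 2 L).comap (adelicVal ↥(maximalRealSubfield L) L (IsCMField.complexConj L) 2 ((StdForm.antidiagonal 2).over L)) : Subgroup (quasiSplit (↥(maximalRealSubfield L)) L (IsCMField.complexConj L) 2).Adelic))
    (φ₀ z : ℂ) (t : AdeleRing (𝓞 ↥(maximalRealSubfield L)) ↥(maximalRealSubfield L)) :
    flatSectionU (fun _ => φ₀) z (((quasiSplit (↥(maximalRealSubfield L)) L (IsCMField.complexConj L) 2).toAdelic (weylLongU ((IsCMField.complexConj L : L ≃ₐ[↥(maximalRealSubfield L)] L) : L →+* L) (rfl : ((StdForm.antidiagonal 2).over L) = ((StdForm.antidiagonal 2).over L)))) *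
          ((middleRootUnipotent hij hN (Multiplicative.ofAdd (traceZeroLine ↥(maximalRealSubfield L) L (IsCMField.complexConj L) hcδ hδ t)) : ↥(adelicUnipotent ↥(maximalRealSubfield L) L (IsCMField.complexConj L) 2)) : (quasiSplit (↥(maximalRealSubfield L)) L (IsCMField.complexConj L) 2).Adelic) * k) =
      (φ₀ * ((∏ w : InfinitePlace L, ((1 : ℝ) + (w δ) ^ 2 * ((InfiniteAdeleRing.ringEquiv_mixedSpace ↥(maximalRealSubfield L) t.1).1 ⟨w.comap (algebraMap ↥(maximalRealSubfield L) L), K2E1HeightBigCellLineFormulaU2.isReal_comap_maximalRealSubfield L w⟩) ^ 2) : ℝ) : ℂ) ^ (-z)) *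
        (((∏ᶠ v : HeightOneSpectrum (𝓞 L), max 1 ‖((traceZeroLine ↥(maximalRealSubfield L) L (IsCMField.complexConj L) hcδ hδ ((0, t.2) : AdeleRing (𝓞 ↥(maximalRealSubfield L)) ↥(maximalRealSubfield L)) : traceZeroAdele ↥(maximalRealSubfield L) L (IsCMField.complexConj L)) : AdeleRing (𝓞 L) L).2 v‖₊ : ℝ≥0) : ℝ) : ℂ) ^ (-z) := by
  have ht : t = (((InfiniteAdeleRing.ringEquiv_mixedSpace ↥(maximalRealSubfield L)).symm (InfiniteAdeleRing.ringEquiv_mixedSpace ↥(maximalRealSubfield L) t.1), t.2) :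
      AdeleRing (𝓞 ↥(maximalRealSubfield L)) ↥(maximalRealSubfield L)) := Prod.ext ((InfiniteAdeleRing.ringEquiv_mixedSpace _).symm_apply_apply _).symm rfl
  rw [flatSectionU_apply]
  conv_lhs => rw [ht]
  rw [coe_borelHeight_weylLongU_line_cpow_eq_cm_two L hij hN hcδ hδ hk z, mul_assoc]

/-- **`h_f(b)^w = ∏ᶠ_v P_v(b_v)^w` in `ℂ`** for every complex `w`: ★ `finprod_max_one_nnnorm_traceZeroLine_snd_eq` (`h_f(b) = ∏ᶠ_v P_v(b_v)` in `ℝ≥0`, finitely many factors `≠ 1`: `P_v(b_v) = 1` off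
`S_δ ∪ {v : b_v ∉ 𝒪_v}`) pushed through the monoid hom `x ↦ (x : ℂ)^w` of `ℝ≥0` (`(xy)^w = x^w y^w` for `x, y ≥ 0`). [cite: TateThesis1967, §3.3] -/
theorem coe_finFactor_cpow_eq_finprod (w : ℂ) (b : FiniteAdeleRing (𝓞 ↥(maximalRealSubfield L)) ↥(maximalRealSubfield L)) :
    (((∏ᶠ v : HeightOneSpectrum (𝓞 L), max 1 ‖((traceZeroLine ↥(maximalRealSubfield L) L (IsCMField.complexConj L) hcδ hδ ((0, b) : AdeleRing (𝓞 ↥(maximalRealSubfield L)) ↥(maximalRealSubfield L)) : traceZeroAdele ↥(maximalRealSubfield L) L (IsCMField.complexConj L)) : AdeleRing (𝓞 L) L).2 v‖₊ : ℝ≥0) : ℝ) : ℂ) ^ w =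
      ∏ᶠ v : HeightOneSpectrum (𝓞 ↥(maximalRealSubfield L)), ((((letI := Extension.fintype (𝓞 ↥(maximalRealSubfield L)) ↥(maximalRealSubfield L) L (𝓞 L) v;
        ∏ w' : v.Extension (𝓞 L), max 1 (normAbs (w'.1.adicCompletion L) (Extension.adicCompletionSemialgHom ↥(maximalRealSubfield L) L w' (b v)) * normAbs (w'.1.adicCompletion L) ((algebraMap L (FiniteAdeleRing (𝓞 L) L) δ) w'.1)) : ℝ≥0) : ℝ) : ℂ) ^ w) := by
  haveI : Algebra.IsQuadraticExtension ↥(maximalRealSubfield L) L := IsCMField.isQuadraticExtension L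
  rw [finprod_max_one_nnnorm_traceZeroLine_snd_eq (IsCMField.complexConj L) hcδ hδ 0 b]
  -- `x ↦ (x : ℂ)^w` is a monoid hom on `ℝ≥0`
  set φ : ℝ≥0 →* ℂ := ⟨⟨fun x => ((x : ℝ) : ℂ) ^ w, by rw [NNReal.coe_one, Complex.ofReal_one, Complex.one_cpow]⟩, fun x y => by
    simp only [NNReal.coe_mul, Complex.ofReal_mul]; exact Complex.mul_cpow_ofReal_nonneg x.2 y.2 w⟩ with hφ
  have hsupp : (Function.mulSupport fun v : HeightOneSpectrum (𝓞 ↥(maximalRealSubfield L)) => (letI := Extension.fintype (𝓞 ↥(maximalRealSubfield L)) ↥(maximalRealSubfield L) L (𝓞 L) v;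
      ∏ w' : v.Extension (𝓞 L), max 1 (normAbs (w'.1.adicCompletion L) (Extension.adicCompletionSemialgHom ↥(maximalRealSubfield L) L w' (b v)) * normAbs (w'.1.adicCompletion L) ((algebraMap L (FiniteAdeleRing (𝓞 L) L) δ) w'.1)))).Finite :=
    finite_mulSupport_localFactor ↥(maximalRealSubfield L) (S := (finite_setOf_exists_extension_normAbs_ne_one (F := ↥(maximalRealSubfield L)) (E := L) hδ).toFinset)
      (fun v hv t ht => prod_extension_max_one_eq_one_of_mem_integers (E := L) v (fun w' => not_not.1 fun h => hv ((Set.Finite.mem_toFinset _).2 ⟨w', h⟩)) ht) b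
  exact φ.map_finprod hsupp

/-! ## §2 THE HEAD: `μ(D)⁻¹·Φ̂_k(ξ) = |d_{L⁺}|^{−1∕2} · (φ₀·∏_w 𝓦_w(ξ,z)) · (μ_f(𝒪̂)⁻¹·∫ h_f^{−z}·ψ_f(ξ·) dμ_f)` -/

section Head

/-- **THE ARCHIMEDEAN FACTOR**: `∫_{L⁺⊗ℝ} (φ₀·A(s)^{−z})·𝐞(−Tr(ξs)) ds = φ₀ · ∏_{w∣∞ of L} ∫_ℝ (1 + (wδ)²x²)^{−z}·e^{−2πi·ξ_w·x} dx` (`ξ_w = (mixedEmbedding L⁺ ξ)_{w|L⁺}`): the symbol splits over the places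
(★ `ofReal_prod_cpow`), the places of `L⁺` are the `w|_{L⁺}` (Mathlib `IsCMField.equivInfinitePlace`), and FILE 1 `integral_prod_mul_fourierChar_eq_prod_of_equiv`; each factor is the kernel of ★ W2-arch
`integral_onePlusSqPow_mul_phase_eq` :144. [cite: Bump1997, §1.6 (1.26)] [cite: Garrett2018, §1.10] -/
theorem integral_archFactor_cpow_mul_fourierChar_eq_cm_two (φ₀ z : ℂ) (ξ : ↥(maximalRealSubfield L)) :
    ∫ s : mixedSpace ↥(maximalRealSubfield L), (φ₀ * ((∏ w : InfinitePlace L, ((1 : ℝ) + (w δ) ^ 2 * (s.1 ⟨w.comap (algebraMap ↥(maximalRealSubfield L) L), K2E1HeightBigCellLineFormulaU2.isReal_comap_maximalRealSubfield L w⟩) ^ 2) : ℝ) : ℂ) ^ (-z)) * (𝐞 (-(mixedTrace ↥(maximalRealSubfield L) (mixedEmbedding ↥(maximalRealSubfield L) ξ * s))) : ℂ) =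
      (φ₀ * ∏ w : InfinitePlace L, ∫ x : ℝ, (((1 + (w δ) ^ 2 * x ^ 2 : ℝ)) : ℂ) ^ (-z) *
          Complex.exp (-(2 * π * Complex.I * (mixedEmbedding ↥(maximalRealSubfield L) ξ).1 ⟨w.comap (algebraMap ↥(maximalRealSubfield L) L), K2E1HeightBigCellLineFormulaU2.isReal_comap_maximalRealSubfield L w⟩ * x))) := by
  -- the places `w ∣ ∞` of `L` ARE the (real) places of `L⁺`, `w ↦ w|_{L⁺}`
  let e : InfinitePlace L ≃ {v : InfinitePlace ↥(maximalRealSubfield L) // v.IsReal} :=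
    (IsCMField.equivInfinitePlace L).trans (Equiv.subtypeUnivEquiv fun v : InfinitePlace ↥(maximalRealSubfield L) => IsTotallyReal.isReal v).symm
  have he : ∀ w : InfinitePlace L, e w = ⟨w.comap (algebraMap ↥(maximalRealSubfield L) L), K2E1HeightBigCellLineFormulaU2.isReal_comap_maximalRealSubfield L w⟩ := fun w => rfl
  have key := integral_prod_mul_fourierChar_eq_prod_of_equiv ↥(maximalRealSubfield L) e (fun w (x : ℝ) => (((1 + (w δ) ^ 2 * x ^ 2 : ℝ)) : ℂ) ^ (-z)) ξ
  simp only [he] at key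
  have hsplit : ∀ s : mixedSpace ↥(maximalRealSubfield L), ((∏ w : InfinitePlace L, ((1 : ℝ) + (w δ) ^ 2 * (s.1 ⟨w.comap (algebraMap ↥(maximalRealSubfield L) L), K2E1HeightBigCellLineFormulaU2.isReal_comap_maximalRealSubfield L w⟩) ^ 2) : ℝ) : ℂ) ^ (-z) =
      ∏ w : InfinitePlace L, (((1 + (w δ) ^ 2 * (s.1 ⟨w.comap (algebraMap ↥(maximalRealSubfield L) L), K2E1HeightBigCellLineFormulaU2.isReal_comap_maximalRealSubfield L w⟩) ^ 2 : ℝ)) : ℂ) ^ (-z) :=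
    fun s => ofReal_prod_cpow Finset.univ _ (fun w _ => by positivity) (-z)
  have hpt : ∀ s : mixedSpace ↥(maximalRealSubfield L),
      (φ₀ * ((∏ w : InfinitePlace L, ((1 : ℝ) + (w δ) ^ 2 * (s.1 ⟨w.comap (algebraMap ↥(maximalRealSubfield L) L), K2E1HeightBigCellLineFormulaU2.isReal_comap_maximalRealSubfield L w⟩) ^ 2) : ℝ) : ℂ) ^ (-z)) * (𝐞 (-(mixedTrace ↥(maximalRealSubfield L) (mixedEmbedding ↥(maximalRealSubfield L) ξ * s))) : ℂ) =
        φ₀ * ((∏ w : InfinitePlace L, (((1 + (w δ) ^ 2 * (s.1 ⟨w.comap (algebraMap ↥(maximalRealSubfield L) L), K2E1HeightBigCellLineFormulaU2.isReal_comap_maximalRealSubfield L w⟩) ^ 2 : ℝ)) : ℂ) ^ (-z)) *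
          (𝐞 (-(mixedTrace ↥(maximalRealSubfield L) (mixedEmbedding ↥(maximalRealSubfield L) ξ * s))) : ℂ)) := fun s => by
    rw [hsplit s, mul_assoc]
  simp_rw [hpt]
  rw [integral_const_mul, key]

variable [MeasurableSpace (AdeleRing (𝓞 ↥(maximalRealSubfield L)) ↥(maximalRealSubfield L))] [BorelSpace (AdeleRing (𝓞 ↥(maximalRealSubfield L)) ↥(maximalRealSubfield L))]
  [MeasurableSpace (FiniteAdeleRing (𝓞 ↥(maximalRealSubfield L)) ↥(maximalRealSubfield L))] [BorelSpace (FiniteAdeleRing (𝓞 ↥(maximalRealSubfield L)) ↥(maximalRealSubfield L))]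

/-- **W3 HEAD (the conventions memo's reconciliation line (R)).**  `L` CM, `L⁺` its maximal real subfield, `U(1,1) = U(J₂)_{L∕L⁺}`, `δ ∈ L⁻ ∖ 0`, `k ∈ K_U`; `μ := σ_*(volume ⊗ μ_f)` the split Haar
measure of `𝔸_{L⁺}` (`σ(s,b) = (ι⁻¹s, b)`, `μ_f` ANY (`SFinite`) measure on `𝔸_{L⁺,f}`), `Φ_k(t) = (φ₀·A(ι t_∞)^{−z})·h_f(t_f)^{−z}` the big-cell function of the spherical flat section along the line
(§1 `flatSectionU_const_weylLongU_line_eq_cm_two`).  Then for EVERY `z : ℂ` and `ξ ∈ L⁺`: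
`μ(D)⁻¹ · Φ̂_k(ξ) = (√|d_{L⁺}|)⁻¹ · (φ₀·∏_{w∣∞ of L} ∫_ℝ (1 + (wδ)²x²)^{−z}·e^{−2πi·ξ_w·x} dx) · (μ_f(𝒪̂)⁻¹·∫ h_f(b)^{−z}·ψ_f(ξb) dμ_f(b))`
(FILE 1: the coefficient splits, `μ(D) = volume(D_∞)·μ_f(𝒪̂) = √|d_{L⁺}|·μ_f(𝒪̂)`; no integrability needed — both sides carry the same Bochner junk; for `Re z > 1` everything converges).
[cite: Garrett2018, §1.9–§1.10] [cite: Bump1997, §3.7] [cite: TateThesis1967, §4.1] -/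
theorem inv_measure_mul_adeleFourierCoeff_line_eq_cm_two (μf : Measure (FiniteAdeleRing (𝓞 ↥(maximalRealSubfield L)) ↥(maximalRealSubfield L))) [SFinite μf]
    {σ : mixedSpace ↥(maximalRealSubfield L) × FiniteAdeleRing (𝓞 ↥(maximalRealSubfield L)) ↥(maximalRealSubfield L) → AdeleRing (𝓞 ↥(maximalRealSubfield L)) ↥(maximalRealSubfield L)}
    (hσ : ∀ p, (σ p).1 = (InfiniteAdeleRing.ringEquiv_mixedSpace ↥(maximalRealSubfield L)).symm p.1 ∧ (σ p).2 = p.2) (φ₀ z : ℂ) (ξ : ↥(maximalRealSubfield L)) :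
    ((((((volume : Measure (mixedSpace ↥(maximalRealSubfield L))).prod μf).map σ) (adeleFundamentalDomain ↥(maximalRealSubfield L))).toReal⁻¹ : ℝ) : ℂ) *
        adeleFourierCoeff (((volume : Measure (mixedSpace ↥(maximalRealSubfield L))).prod μf).map σ)
          (fun t => (φ₀ * ((∏ w : InfinitePlace L, ((1 : ℝ) + (w δ) ^ 2 * ((InfiniteAdeleRing.ringEquiv_mixedSpace ↥(maximalRealSubfield L) t.1).1 ⟨w.comap (algebraMap ↥(maximalRealSubfield L) L), K2E1HeightBigCellLineFormulaU2.isReal_comap_maximalRealSubfield L w⟩) ^ 2) : ℝ) : ℂ) ^ (-z)) * (((∏ᶠ v : HeightOneSpectrum (𝓞 L), max 1 ‖((traceZeroLine ↥(maximalRealSubfield L) L (IsCMField.complexConj L) hcδ hδ ((0, t.2) : AdeleRing (𝓞 ↥(maximalRealSubfield L)) ↥(maximalRealSubfield L)) : traceZeroAdele ↥(maximalRealSubfield L) L (IsCMField.complexConj L)) : AdeleRing (𝓞 L) L).2 v‖₊ : ℝ≥0) : ℝ) : ℂ) ^ (-z)) ξ =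
      (((NNReal.sqrt ‖discr ↥(maximalRealSubfield L)‖₊ : ℝ≥0) : ℝ)⁻¹ : ℂ) * (φ₀ * ∏ w : InfinitePlace L, ∫ x : ℝ, (((1 + (w δ) ^ 2 * x ^ 2 : ℝ)) : ℂ) ^ (-z) *
          Complex.exp (-(2 * π * Complex.I * (mixedEmbedding ↥(maximalRealSubfield L) ξ).1 ⟨w.comap (algebraMap ↥(maximalRealSubfield L) L), K2E1HeightBigCellLineFormulaU2.isReal_comap_maximalRealSubfield L w⟩ * x))) *
        ((μf {b : FiniteAdeleRing (𝓞 ↥(maximalRealSubfield L)) ↥(maximalRealSubfield L) | ∀ v, b v ∈ v.adicCompletionIntegers ↥(maximalRealSubfield L)}).toReal⁻¹ •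
          ∫ b, (((∏ᶠ v : HeightOneSpectrum (𝓞 L), max 1 ‖((traceZeroLine ↥(maximalRealSubfield L) L (IsCMField.complexConj L) hcδ hδ ((0, b) : AdeleRing (𝓞 ↥(maximalRealSubfield L)) ↥(maximalRealSubfield L)) : traceZeroAdele ↥(maximalRealSubfield L) L (IsCMField.complexConj L)) : AdeleRing (𝓞 L) L).2 v‖₊ : ℝ≥0) : ℝ) : ℂ) ^ (-z) * (finiteAdeleAddChar ↥(maximalRealSubfield L) (algebraMap ↥(maximalRealSubfield L) (FiniteAdeleRing (𝓞 ↥(maximalRealSubfield L)) ↥(maximalRealSubfield L)) ξ * b) : ℂ) ∂μf) := by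
  have key := adeleFourierCoeff_map_split_eq_mul ↥(maximalRealSubfield L) (volume : Measure (mixedSpace ↥(maximalRealSubfield L))) μf hσ
    (fun s => φ₀ * ((∏ w : InfinitePlace L, ((1 : ℝ) + (w δ) ^ 2 * (s.1 ⟨w.comap (algebraMap ↥(maximalRealSubfield L) L), K2E1HeightBigCellLineFormulaU2.isReal_comap_maximalRealSubfield L w⟩) ^ 2) : ℝ) : ℂ) ^ (-z)) (fun b => (((∏ᶠ v : HeightOneSpectrum (𝓞 L), max 1 ‖((traceZeroLine ↥(maximalRealSubfield L) L (IsCMField.complexConj L) hcδ hδ ((0, b) : AdeleRing (𝓞 ↥(maximalRealSubfield L)) ↥(maximalRealSubfield L)) : traceZeroAdele ↥(maximalRealSubfield L) L (IsCMField.complexConj L)) : AdeleRing (𝓞 L) L).2 v‖₊ : ℝ≥0) : ℝ) : ℂ) ^ (-z)) ξ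
  rw [key, measure_map_split_adeleFundamentalDomain ↥(maximalRealSubfield L) volume μf hσ, volume_fundamentalDomain_latticeBasis_of_isTotallyReal, ENNReal.toReal_mul,
    ENNReal.coe_toReal, integral_archFactor_cpow_mul_fourierChar_eq_cm_two L (δ := δ) φ₀ z ξ, mul_inv, Complex.ofReal_mul, Complex.ofReal_inv, Complex.ofReal_inv,
    Complex.real_smul, Complex.ofReal_inv]
  ring

end Head

/-! ## §3 The finite factor is the Euler product of the local Whittaker integrals `W_v(ξ,z) = ν_v(𝒪_v)⁻¹·∫ P_v(t)^{−z}·ψ_v(ξt) dν_v` -/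

section Euler

omit [IsCMField L] in
/-- The local symbol `P_v(t) ≥ 1`, so `t ↦ P_v(t)^{−z}` is continuous (★ `continuous_prod_extension_max_one`, Mathlib `Continuous.cpow` on the slit plane). [cite: TateThesis1967, §3.3] -/
theorem continuous_localSymbol_cpow (z : ℂ) (v : HeightOneSpectrum (𝓞 ↥(maximalRealSubfield L))) :
    Continuous fun t : v.adicCompletion ↥(maximalRealSubfield L) => ((((letI := Extension.fintype (𝓞 ↥(maximalRealSubfield L)) ↥(maximalRealSubfield L) L (𝓞 L) v;
        ∏ w' : v.Extension (𝓞 L), max 1 (normAbs (w'.1.adicCompletion L) (Extension.adicCompletionSemialgHom ↥(maximalRealSubfield L) L w' t) * normAbs (w'.1.adicCompletion L) ((algebraMap L (FiniteAdeleRing (𝓞 L) L) δ) w'.1))) : ℝ≥0) : ℝ) : ℂ) ^ (-z) := by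
  refine Continuous.cpow (Complex.continuous_ofReal.comp (NNReal.continuous_coe.comp (continuous_prod_extension_max_one (E := L) v))) continuous_const fun t => ?_
  refine Complex.ofReal_mem_slitPlane.2 (lt_of_lt_of_le zero_lt_one ?_)
  letI := Extension.fintype (𝓞 ↥(maximalRealSubfield L)) ↥(maximalRealSubfield L) L (𝓞 L) v
  exact_mod_cast Finset.one_le_prod' fun w' _ => le_max_left _ _

variable [MeasurableSpace (FiniteAdeleRing (𝓞 ↥(maximalRealSubfield L)) ↥(maximalRealSubfield L))] [BorelSpace (FiniteAdeleRing (𝓞 ↥(maximalRealSubfield L)) ↥(maximalRealSubfield L))]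
  [∀ v : HeightOneSpectrum (𝓞 ↥(maximalRealSubfield L)), MeasurableSpace (v.adicCompletion ↥(maximalRealSubfield L))]
  [∀ v : HeightOneSpectrum (𝓞 ↥(maximalRealSubfield L)), BorelSpace (v.adicCompletion ↥(maximalRealSubfield L))]

/-- **THE FINITE FACTOR IS THE EULER PRODUCT OF THE LOCAL WHITTAKER INTEGRALS.**  With `W_v(ξ,z) = ν_v(𝒪_v)⁻¹·∫_{L⁺_v} P_v(t)^{−z}·ψ_v(ξt) dν_v(t)` (ANY Haar `ν_v`; `P_v(t) = max(1,‖t‖_v)²` off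
`S_δ` ★, i.e. W2-fin's integrand) and under the single binder `hint : h_f^{−z} ∈ L¹(μ_f)` (= `h_f^{−Re z} ∈ L¹`; Godement at CM for `Re z > 1`, payer K2E2-p12 «R7₂ FILE 3 (3b)» §3):
**`HasProd W (μ_f(𝒪̂)⁻¹·∫ h_f(b)^{−z}·ψ_f(ξb) dμ_f(b))`** — FILE 1 `hasProd_localCoeff_of_integrable` at `g_v = P_v^{−z}` (continuous, `= 1` on `𝒪_v` off the finite `S_δ` ★) and §1 `h_f^{−z} = ∏ᶠ_v P_v(b_v)^{−z}`.
[cite: TateThesis1967, Thm 3.3.1] [cite: Bump1997, §3.7] -/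
theorem hasProd_localWhittaker_line_cm_two (μf : Measure (FiniteAdeleRing (𝓞 ↥(maximalRealSubfield L)) ↥(maximalRealSubfield L))) [μf.IsAddHaarMeasure]
    (ν : ∀ v : HeightOneSpectrum (𝓞 ↥(maximalRealSubfield L)), Measure (v.adicCompletion ↥(maximalRealSubfield L))) [∀ v, (ν v).IsAddHaarMeasure] (z : ℂ) (ξ : ↥(maximalRealSubfield L))
    (hint : Integrable (fun b : FiniteAdeleRing (𝓞 ↥(maximalRealSubfield L)) ↥(maximalRealSubfield L) => (((∏ᶠ v : HeightOneSpectrum (𝓞 L), max 1 ‖((traceZeroLine ↥(maximalRealSubfield L) L (IsCMField.complexConj L) hcδ hδ ((0, b) : AdeleRing (𝓞 ↥(maximalRealSubfield L)) ↥(maximalRealSubfield L)) : traceZeroAdele ↥(maximalRealSubfield L) L (IsCMField.complexConj L)) : AdeleRing (𝓞 L) L).2 v‖₊ : ℝ≥0) : ℝ) : ℂ) ^ (-z)) μf) :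
    HasProd (fun v : HeightOneSpectrum (𝓞 ↥(maximalRealSubfield L)) => (ν v (v.adicCompletionIntegers ↥(maximalRealSubfield L))).toReal⁻¹ •
        ∫ t, ((((letI := Extension.fintype (𝓞 ↥(maximalRealSubfield L)) ↥(maximalRealSubfield L) L (𝓞 L) v;
        ∏ w' : v.Extension (𝓞 L), max 1 (normAbs (w'.1.adicCompletion L) (Extension.adicCompletionSemialgHom ↥(maximalRealSubfield L) L w' t) * normAbs (w'.1.adicCompletion L) ((algebraMap L (FiniteAdeleRing (𝓞 L) L) δ) w'.1))) : ℝ≥0) : ℝ) : ℂ) ^ (-z) * (adeleAddCharAt ↥(maximalRealSubfield L) v ((ξ : v.adicCompletion ↥(maximalRealSubfield L)) * t) : ℂ) ∂ν v)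
      ((μf {b : FiniteAdeleRing (𝓞 ↥(maximalRealSubfield L)) ↥(maximalRealSubfield L) | ∀ v, b v ∈ v.adicCompletionIntegers ↥(maximalRealSubfield L)}).toReal⁻¹ •
          ∫ b, (((∏ᶠ v : HeightOneSpectrum (𝓞 L), max 1 ‖((traceZeroLine ↥(maximalRealSubfield L) L (IsCMField.complexConj L) hcδ hδ ((0, b) : AdeleRing (𝓞 ↥(maximalRealSubfield L)) ↥(maximalRealSubfield L)) : traceZeroAdele ↥(maximalRealSubfield L) L (IsCMField.complexConj L)) : AdeleRing (𝓞 L) L).2 v‖₊ : ℝ≥0) : ℝ) : ℂ) ^ (-z) * (finiteAdeleAddChar ↥(maximalRealSubfield L) (algebraMap ↥(maximalRealSubfield L) (FiniteAdeleRing (𝓞 ↥(maximalRealSubfield L)) ↥(maximalRealSubfield L)) ξ * b) : ℂ) ∂μf) := by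
  classical
  haveI : Algebra.IsQuadraticExtension ↥(maximalRealSubfield L) L := IsCMField.isQuadraticExtension L
  have hg1 : ∀ v ∉ (finite_setOf_exists_extension_normAbs_ne_one (F := ↥(maximalRealSubfield L)) (E := L) hδ).toFinset, ∀ t ∈ v.adicCompletionIntegers ↥(maximalRealSubfield L),
      ((((letI := Extension.fintype (𝓞 ↥(maximalRealSubfield L)) ↥(maximalRealSubfield L) L (𝓞 L) v;
        ∏ w' : v.Extension (𝓞 L), max 1 (normAbs (w'.1.adicCompletion L) (Extension.adicCompletionSemialgHom ↥(maximalRealSubfield L) L w' t) * normAbs (w'.1.adicCompletion L) ((algebraMap L (FiniteAdeleRing (𝓞 L) L) δ) w'.1))) : ℝ≥0) : ℝ) : ℂ) ^ (-z) = 1 := by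
    intro v hv t ht
    rw [prod_extension_max_one_eq_one_of_mem_integers (E := L) v (fun w' => not_not.1 fun h => hv ((Set.Finite.mem_toFinset _).2 ⟨w', h⟩)) ht, NNReal.coe_one, Complex.ofReal_one,
      Complex.one_cpow]
  have hfin : ∀ b : FiniteAdeleRing (𝓞 ↥(maximalRealSubfield L)) ↥(maximalRealSubfield L),
      (∏ᶠ v : HeightOneSpectrum (𝓞 ↥(maximalRealSubfield L)), ((((letI := Extension.fintype (𝓞 ↥(maximalRealSubfield L)) ↥(maximalRealSubfield L) L (𝓞 L) v;
        ∏ w' : v.Extension (𝓞 L), max 1 (normAbs (w'.1.adicCompletion L) (Extension.adicCompletionSemialgHom ↥(maximalRealSubfield L) L w' (b v)) * normAbs (w'.1.adicCompletion L) ((algebraMap L (FiniteAdeleRing (𝓞 L) L) δ) w'.1))) : ℝ≥0) : ℝ) : ℂ) ^ (-z)) = (((∏ᶠ v : HeightOneSpectrum (𝓞 L), max 1 ‖((traceZeroLine ↥(maximalRealSubfield L) L (IsCMField.complexConj L) hcδ hδ ((0, b) : AdeleRing (𝓞 ↥(maximalRealSubfield L)) ↥(maximalRealSubfield L)) : traceZeroAdele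 ↥(maximalRealSubfield L) L (IsCMField.complexConj L)) : AdeleRing (𝓞 L) L).2 v‖₊ : ℝ≥0) : ℝ) : ℂ) ^ (-z) := fun b =>
    (coe_finFactor_cpow_eq_finprod L hcδ hδ (-z) b).symm
  have h := hasProd_localCoeff_of_integrable ↥(maximalRealSubfield L) μf ν (fun v t => ((((letI := Extension.fintype (𝓞 ↥(maximalRealSubfield L)) ↥(maximalRealSubfield L) L (𝓞 L) v;
        ∏ w' : v.Extension (𝓞 L), max 1 (normAbs (w'.1.adicCompletion L) (Extension.adicCompletionSemialgHom ↥(maximalRealSubfield L) L w' t) * normAbs (w'.1.adicCompletion L) ((algebraMap L (FiniteAdeleRing (𝓞 L) L) δ) w'.1))) : ℝ≥0) : ℝ) : ℂ) ^ (-z)) _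
    (fun v => continuous_localSymbol_cpow L z v) hg1 ξ (by simp_rw [hfin]; exact hint)
  simp_rw [hfin] at h
  exact h

/-! ## §4 Regrouped: entire archimedean factors × a finite product of local integrals × `1∕ζ^S_{L⁺}(2z)` -/

/-- **THE WHITTAKER COEFFICIENT, REGROUPED OFF A FINITE SET** (the form W4 ★ ∕ W5-A ★ consume).  Under `hint` (§3) and the NAMED unramified values `hW : ∀ v ∉ S, W_v(ξ,z) = 1 − q_v^{−2z}`
(W2-fin (d) at the places `v ∉ S ⊇ S_δ ∪ {v : ord_v ξ ≠ m_v}`, K2-defs1 (g4)), for `Re z > ½`: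
`μ(D)⁻¹·Φ̂_k(ξ) = (√|d_{L⁺}|)⁻¹ · (φ₀·∏_{w∣∞} ∫_ℝ (1 + (wδ)²x²)^{−z} e^{−2πi ξ_w x} dx) · ((∏_{v∈S} W_v(ξ,z)) · ζ^S_{L⁺}(2z)⁻¹)` (§2, §3, FILE 1 §4, `HasProd.unique`).
[cite: Garrett2018, §1.10] [cite: Bump1997, §3.7] [cite: MoeglinWaldspurger1995, II.1.7] -/
theorem inv_measure_mul_adeleFourierCoeff_line_eq_prod_cm_two [MeasurableSpace (AdeleRing (𝓞 ↥(maximalRealSubfield L)) ↥(maximalRealSubfield L))] [BorelSpace (AdeleRing (𝓞 ↥(maximalRealSubfield L)) ↥(maximalRealSubfield L))]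
    (μf : Measure (FiniteAdeleRing (𝓞 ↥(maximalRealSubfield L)) ↥(maximalRealSubfield L))) [μf.IsAddHaarMeasure]
    (ν : ∀ v : HeightOneSpectrum (𝓞 ↥(maximalRealSubfield L)), Measure (v.adicCompletion ↥(maximalRealSubfield L))) [∀ v, (ν v).IsAddHaarMeasure]
    {σ : mixedSpace ↥(maximalRealSubfield L) × FiniteAdeleRing (𝓞 ↥(maximalRealSubfield L)) ↥(maximalRealSubfield L) → AdeleRing (𝓞 ↥(maximalRealSubfield L)) ↥(maximalRealSubfield L)}
    (hσ : ∀ p, (σ p).1 = (InfiniteAdeleRing.ringEquiv_mixedSpace ↥(maximalRealSubfield L)).symm p.1 ∧ (σ p).2 = p.2) (φ₀ : ℂ) {z : ℂ} (hz : 1 / 2 < z.re) (ξ : ↥(maximalRealSubfield L))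
    (hint : Integrable (fun b : FiniteAdeleRing (𝓞 ↥(maximalRealSubfield L)) ↥(maximalRealSubfield L) => (((∏ᶠ v : HeightOneSpectrum (𝓞 L), max 1 ‖((traceZeroLine ↥(maximalRealSubfield L) L (IsCMField.complexConj L) hcδ hδ ((0, b) : AdeleRing (𝓞 ↥(maximalRealSubfield L)) ↥(maximalRealSubfield L)) : traceZeroAdele ↥(maximalRealSubfield L) L (IsCMField.complexConj L)) : AdeleRing (𝓞 L) L).2 v‖₊ : ℝ≥0) : ℝ) : ℂ) ^ (-z)) μf)
    (S : Finset (HeightOneSpectrum (𝓞 ↥(maximalRealSubfield L))))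
    (hW : ∀ v ∉ S, (ν v (v.adicCompletionIntegers ↥(maximalRealSubfield L))).toReal⁻¹ •
        ∫ t, ((((letI := Extension.fintype (𝓞 ↥(maximalRealSubfield L)) ↥(maximalRealSubfield L) L (𝓞 L) v;
        ∏ w' : v.Extension (𝓞 L), max 1 (normAbs (w'.1.adicCompletion L) (Extension.adicCompletionSemialgHom ↥(maximalRealSubfield L) L w' t) * normAbs (w'.1.adicCompletion L) ((algebraMap L (FiniteAdeleRing (𝓞 L) L) δ) w'.1))) : ℝ≥0) : ℝ) : ℂ) ^ (-z) * (adeleAddCharAt ↥(maximalRealSubfield L) v ((ξ : v.adicCompletion ↥(maximalRealSubfield L)) * t) : ℂ) ∂ν v =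
      1 - (v.residueCard : ℂ) ^ (-(2 * z))) :
    ((((((volume : Measure (mixedSpace ↥(maximalRealSubfield L))).prod μf).map σ) (adeleFundamentalDomain ↥(maximalRealSubfield L))).toReal⁻¹ : ℝ) : ℂ) *
        adeleFourierCoeff (((volume : Measure (mixedSpace ↥(maximalRealSubfield L))).prod μf).map σ)
          (fun t => (φ₀ * ((∏ w : InfinitePlace L, ((1 : ℝ) + (w δ) ^ 2 * ((InfiniteAdeleRing.ringEquiv_mixedSpace ↥(maximalRealSubfield L) t.1).1 ⟨w.comap (algebraMap ↥(maximalRealSubfield L) L), K2E1HeightBigCellLineFormulaU2.isReal_comap_maximalRealSubfield L w⟩) ^ 2) : ℝ) : ℂ) ^ (-z)) * (((∏ᶠ v : HeightOneSpectrum (𝓞 L), max 1 ‖((traceZeroLine ↥(maximalRealSubfield L) L (IsCMField.complexConj L) hcδ hδ ((0, t.2) : AdeleRing (𝓞 ↥(maximalRealSubfield L)) ↥(maximalRealSubfield L)) : traceZeroAdele ↥(maximalRealSubfield L) L (IsCMField.complexConj L)) : AdeleRing (𝓞 L) L).2 v‖₊ : ℝ≥0) : ℝ) : ℂ) ^ (-z))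 ξ =
      (((NNReal.sqrt ‖discr ↥(maximalRealSubfield L)‖₊ : ℝ≥0) : ℝ)⁻¹ : ℂ) * (φ₀ * ∏ w : InfinitePlace L, ∫ x : ℝ, (((1 + (w δ) ^ 2 * x ^ 2 : ℝ)) : ℂ) ^ (-z) *
          Complex.exp (-(2 * π * Complex.I * (mixedEmbedding ↥(maximalRealSubfield L) ξ).1 ⟨w.comap (algebraMap ↥(maximalRealSubfield L) L), K2E1HeightBigCellLineFormulaU2.isReal_comap_maximalRealSubfield L w⟩ * x))) *
        ((∏ v ∈ S, (ν v (v.adicCompletionIntegers ↥(maximalRealSubfield L))).toReal⁻¹ •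
            ∫ t, ((((letI := Extension.fintype (𝓞 ↥(maximalRealSubfield L)) ↥(maximalRealSubfield L) L (𝓞 L) v;
        ∏ w' : v.Extension (𝓞 L), max 1 (normAbs (w'.1.adicCompletion L) (Extension.adicCompletionSemialgHom ↥(maximalRealSubfield L) L w' t) * normAbs (w'.1.adicCompletion L) ((algebraMap L (FiniteAdeleRing (𝓞 L) L) δ) w'.1))) : ℝ≥0) : ℝ) : ℂ) ^ (-z) * (adeleAddCharAt ↥(maximalRealSubfield L) v ((ξ : v.adicCompletion ↥(maximalRealSubfield L)) * t) : ℂ) ∂ν v) *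
          (partialStandardL (S : Set (HeightOneSpectrum (𝓞 ↥(maximalRealSubfield L)))) (fun _ => ({1} : Multiset ℂ)) (2 * z))⁻¹) := by
  haveI : SecondCountableTopology (FiniteAdeleRing (𝓞 ↥(maximalRealSubfield L)) ↥(maximalRealSubfield L)) := secondCountableTopology_finiteAdeleRing _
  haveI : LocallyCompactSpace (FiniteAdeleRing (𝓞 ↥(maximalRealSubfield L)) ↥(maximalRealSubfield L)) := locallyCompactSpace_finiteAdeleRing' _
  rw [inv_measure_mul_adeleFourierCoeff_line_eq_cm_two L hcδ hδ μf hσ φ₀ z ξ,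
    (hasProd_localWhittaker_line_cm_two L hcδ hδ μf ν z ξ hint).unique (hasProd_mul_inv_partialZeta_of_eq_off S hz hW).1]

end Euler

end Summit.HodgeConjecture.HodgeConjecture.Cruxes.H413.K2E1WhittakerCoefficientEulerProductU2

end
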